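import Summits.QuantumFields.YangMills.Theorems.BalabanUVNodesN21DilationRoadAtRecord13CoPH

/-!
# YM-DAG node N21 (= NE7c) · the dilation road's END at the Stage-13 `CoPH` spine home — SANITY ∕ VACUITY GUARD (A2 ∕ A6) for
# `BalabanUVNodesN21DilationRoadAtRecord13CoPH`: the dilation package of its §2 ∕ §3 is INHABITED by non-degenerate data and the
# theorems FIRE on it

Track A of `YM-PLAN.md` (cell `pub-ymgap`, HUMAN RULING D-0062 ∕ D-0149 width seats), node **N21**; WIDTH SEAT `pub-ymgap-dag-n21-w2`
(gen 0), companion of file 1 `…N21DilationRoadAtRecord13CoPH` (W-SEAT-START-LIST v3 §n21 ITEM 2), split off for the 400-line rule —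
as n21-a's files 3′ ∕ 6′ ∕ 8′ were for files 3 ∕ 6 ∕ 8.  THEOREMS ONLY: 0 `def`, 0 `sorry`, standard axioms; COUNT-NEUTRAL;
`--kind proof --supports stmt-QuantumFields-20544 --as helper`.  Imports file 1 only.

WHAT IS PROVED ([folklore]).
* `dilationLevels_toyLedger` — the one-slot toy of `T4ShellMeasureLevels.Toy` (one term of unit weight per step, shell part `ϑ^K`,
  one slot at the top level whose piece is the whole shell part) IS a `LevelLedger` with DILATION constants `M_j·3(d_j+1)∕(1−ρ_j)`,
  `M ≡ 1`, `d ≡ 0`, `ρ_j = ϑ^j∕2` (`0 ≤ ϑ ≤ 1`).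
* `exists_shellWeight_of_dilationLevels_fires` — for `0 < ϑ < 1` a carrier bundle with NONEMPTY classes, POSITIVE weights and POSITIVE
  shell parts carries EXACTLY the ∃-package of file 1's `exists_shellWeight_of_dilationLevels` (two copies of the toy ledger,
  `Toy.liveWindow` with `N₁ = 0`, `ν̄ = 1`, `M̄ = 1`, `d₀ = 0`, `c₁ = ½`, `p = q = 0`), and file 1 §2 FIRES on it (A2: the witness is
  the bundle displayed in the proof; A6: the binder of §2 ∕ §3 is not void).
* `s_N21_sRec₁₃CoPH_of_dilationLevels_fires` — the CONSTANT Stage-13 reading returning that bundle with record weight `6ϑ^K`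
  (summable, dominating the toy's explicit relative shell weight `2·(3∕(1−ϑ^K∕2))·(ϑ^K∕2)`) satisfies the hypothesis of file 1's
  `s_N21_sRec₁₃CoPH_of_dilationLevels` at EVERY Stage-13 tuple, hence `S_N21 (SRec₁₃CoPH cr₀)` by file 1 §3.

HONEST FRAMING.  A vacuity guard, not an estimate: the carriers OF RECORD (NODE O's term object) are not these; whether any
admissible Stage-13 tuple with provisos EXISTS is K0⁷ (OPEN) and is not touched (the constant reading meets the hypothesis at every
tuple, admissible or not); nothing of Bałaban's asserted; NE7c NOT PRINTED ∕ NOT proved; N21 NOT discharged; counts UNMOVED (typed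
28∕28 · discharged 5∕27); one finite four-torus programme at fixed `ε` — NOT ℝ⁴, NOT infinite volume, NOT OS, NOT a mass gap, NOT
Clay.  No decl below carries a cite tag.
-/

set_option autoImplicit false

open Finset

namespace Summit.QuantumFields.YangMills.Theorems.N21DilationRoadAtRecord13CoPH

open Literature.MathematicalPhysics.QuantumFieldTheory.Balaban1983to89
open T4IndicatorShell (ShellWeightBound)
open T4ShellMeasureLevels (LevelLedger LiveWindow)
open YMDAG.UVSplit

/-! ## A2 ∕ A6: the dilation package is inhabited by non-degenerate data, and file 1 §2 ∕ §3 fire on it -/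

section Sanity

open T4ShellMeasureLevels.Toy (T A sh S piece lvl liveWindow)

/-- **THE ONE-SLOT TOY IS A LEVEL LEDGER WITH DILATION CONSTANTS**: one term of unit weight per step with shell part `ϑ^K`, one
slot at the top level whose piece is the whole shell part, multiplier `M ≡ 1`, block dimension `d ≡ 0`, width `ρ_j = ϑ^j∕2`
(`≤ ½`, rate `½·ϑ^j`): the slot field reads `ϑ^K ≤ (1·3(0+1)∕(1−ϑ^K∕2))·(ϑ^K∕2)·1` (true since `1 − ϑ^K∕2 ≤ 1`). [folklore] -/
theorem dilationLevels_toyLedger (l₀ : ℝ) {ϑ : ℝ} (h0 : 0 ≤ ϑ) (h1 : ϑ ≤ 1) :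
    LevelLedger l₀ T A (sh ϑ) S (piece ϑ) lvl
      (fun j => (fun _ : ℕ => (1 : ℝ)) j * (3 * ((fun _ : ℕ => (0 : ℝ)) j + 1) / (1 - (fun j : ℕ => ϑ ^ j / 2) j)))
      (fun j : ℕ => ϑ ^ j / 2) where
  sh_nonneg K _ _ _ _ := pow_nonneg h0 K
  sh_le K _ _ _ _ := pow_le_one₀ h0 h1
  cover K _ _ _ _ := by simp [sh, S, piece]
  slot K _ _ _ _ := by
    have hx0 : 0 ≤ ϑ ^ K := pow_nonneg h0 K
    have hx1 : ϑ ^ K ≤ 1 := pow_le_one₀ h0 h1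
    have hden : 0 < 1 - ϑ ^ K / 2 := by linarith
    have hge : 2 ≤ 3 * ((0 : ℝ) + 1) / (1 - ϑ ^ K / 2) := by
      rw [le_div_iff₀ hden]; linarith
    simp only [T, piece, lvl, A, sum_singleton, one_mul, mul_one]
    nlinarith
  D_nonneg j := by
    have hx1 : ϑ ^ j ≤ 1 := pow_le_one₀ h0 h1
    have hden : 0 < 1 - ϑ ^ j / 2 := by linarith
    simp only [one_mul]
    positivity
  ρ_nonneg j := by
    have := pow_nonneg h0 j
    positivity

/-- **THE DILATION PACKAGE IS INHABITED AND §2 FIRES ON IT (A2 ∕ A6).**  For `0 < ϑ < 1` there is a carrier bundle `S` with nonempty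
classes, positive weights and positive shell parts `ϑ^K` carrying EXACTLY the ∃-package of `exists_shellWeight_of_dilationLevels` (two
copies of `dilationLevels_toyLedger`, `Toy.liveWindow` (`N₁ = 0`, `ν̄ = 1`), `M̄ = 1`, `d₀ = 0`, `c₁ = ½`, `p = q = 0`), hence SOME
`Wsh` with `ShellWeightBound S.l₀ S.T S.A S.B S.shA S.shB Wsh` by §2 — the binder of §2 ∕ §3 is not void. [folklore] -/
theorem exists_shellWeight_of_dilationLevels_fires (l₀ : ℝ) {ϑ : ℝ} (h0 : 0 < ϑ) (h1 : ϑ < 1) :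
    ∃ S : SpineCarriers, (∀ K, (S.T K).Nonempty) ∧ (∀ K t τ, 0 < S.A K t τ ∧ 0 < S.B K t τ ∧ 0 < S.shA K t τ ∧ 0 < S.shB K t τ) ∧
      (∃ (σA σB : Type) (SA : ℕ → Finset σA) (SB : ℕ → Finset σB) (pieceA : ℕ → ℝ → σA → S.ι → ℝ)
        (pieceB : ℕ → ℝ → σB → S.ι → ℝ) (lvlA : ℕ → σA → ℕ) (lvlB : ℕ → σB → ℕ) (MA dA ρA MB dB ρB : ℕ → ℝ)
        (N₁ : ℕ) (νbar Mbar d₀ c₁ ϑ : ℝ) (p q : ℕ),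
        LevelLedger S.l₀ S.T S.A S.shA SA pieceA lvlA (fun j => MA j * (3 * (dA j + 1) / (1 - ρA j))) ρA ∧
        LevelLedger S.l₀ S.T S.B S.shB SB pieceB lvlB (fun j => MB j * (3 * (dB j + 1) / (1 - ρB j))) ρB ∧
        LiveWindow SA lvlA N₁ νbar ∧ LiveWindow SB lvlB N₁ νbar ∧ 0 ≤ ϑ ∧ ϑ < 1 ∧
        (∀ j, 0 ≤ MA j) ∧ (∀ j, MA j ≤ Mbar * ((j : ℝ) ^ q + 1)) ∧ (∀ j, 0 ≤ MB j) ∧ (∀ j, MB j ≤ Mbar * ((j : ℝ) ^ q + 1)) ∧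
        (∀ j, 0 ≤ dA j) ∧ (∀ j, dA j ≤ d₀ * ((j : ℝ) ^ p + 1)) ∧ (∀ j, 0 ≤ dB j) ∧ (∀ j, dB j ≤ d₀ * ((j : ℝ) ^ p + 1)) ∧
        (∀ j, ρA j ≤ 1 / 2) ∧ (∀ j, ρA j ≤ c₁ * ϑ ^ j) ∧ (∀ j, ρB j ≤ 1 / 2) ∧ (∀ j, ρB j ≤ c₁ * ϑ ^ j)) ∧
      ∃ Wsh : ℕ → ℝ, ShellWeightBound S.l₀ S.T S.A S.B S.shA S.shB Wsh := by
  have hL := dilationLevels_toyLedger l₀ h0.le h1.le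
  let S₀ : SpineCarriers :=
    { ι := Unit, l₀ := l₀, vol := 1, K₀ := 0, T := T, A := A, B := A, shA := sh ϑ, shB := sh ϑ, Bad := fun _ _ => ∅,
      W := fun _ => 0, Wsh := fun K => 6 * ϑ ^ K, δ := fun _ => 0 }
  have hpk : ∃ (σA σB : Type) (SA : ℕ → Finset σA) (SB : ℕ → Finset σB) (pieceA : ℕ → ℝ → σA → S₀.ι → ℝ)
      (pieceB : ℕ → ℝ → σB → S₀.ι → ℝ) (lvlA : ℕ → σA → ℕ) (lvlB : ℕ → σB → ℕ) (MA dA ρA MB dB ρB : ℕ → ℝ)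
      (N₁ : ℕ) (νbar Mbar d₀ c₁ ϑ : ℝ) (p q : ℕ),
      LevelLedger S₀.l₀ S₀.T S₀.A S₀.shA SA pieceA lvlA (fun j => MA j * (3 * (dA j + 1) / (1 - ρA j))) ρA ∧
      LevelLedger S₀.l₀ S₀.T S₀.B S₀.shB SB pieceB lvlB (fun j => MB j * (3 * (dB j + 1) / (1 - ρB j))) ρB ∧
      LiveWindow SA lvlA N₁ νbar ∧ LiveWindow SB lvlB N₁ νbar ∧ 0 ≤ ϑ ∧ ϑ < 1 ∧
      (∀ j, 0 ≤ MA j) ∧ (∀ j, MA j ≤ Mbar * ((j : ℝ) ^ q + 1)) ∧ (∀ j, 0 ≤ MB j) ∧ (∀ j, MB j ≤ Mbar * ((j : ℝ) ^ q + 1)) ∧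
      (∀ j, 0 ≤ dA j) ∧ (∀ j, dA j ≤ d₀ * ((j : ℝ) ^ p + 1)) ∧ (∀ j, 0 ≤ dB j) ∧ (∀ j, dB j ≤ d₀ * ((j : ℝ) ^ p + 1)) ∧
      (∀ j, ρA j ≤ 1 / 2) ∧ (∀ j, ρA j ≤ c₁ * ϑ ^ j) ∧ (∀ j, ρB j ≤ 1 / 2) ∧ (∀ j, ρB j ≤ c₁ * ϑ ^ j) := by
    refine ⟨Unit, Unit, S, S, piece ϑ, piece ϑ, lvl, lvl, fun _ => 1, fun _ => 0, fun j => ϑ ^ j / 2, fun _ => 1, fun _ => 0,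
      fun j => ϑ ^ j / 2, 0, 1, 1, 0, 1 / 2, ϑ, 0, 0, hL, hL, liveWindow, liveWindow, h0.le, h1, fun _ => zero_le_one, ?_,
      fun _ => zero_le_one, ?_, fun _ => le_rfl, ?_, fun _ => le_rfl, ?_, ?_, ?_, ?_, ?_⟩
    · intro j; simp
    · intro j; simp
    · intro j; simp
    · intro j; simp
    · intro j; have := pow_le_one₀ h0.le h1.le (n := j); linarith
    · intro j; linarith
    · intro j; have := pow_le_one₀ h0.le h1.le (n := j); linarith
    · intro j; linarith
  refine ⟨S₀, fun K => ⟨(), by simp [S₀, T]⟩, fun K t τ => ?_, hpk, exists_shellWeight_of_dilationLevels S₀ hpk⟩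
  exact ⟨by simp [S₀, A], by simp [S₀, A], by simpa [S₀, sh] using pow_pos h0 K, by simpa [S₀, sh] using pow_pos h0 K⟩

/-- **§3 FIRES ON THE CONSTANT TOY READING (A2 ∕ A6 at the record).**  The Stage-13 reading that returns, at every tuple, the toy
bundle with record weight `S.Wsh K = 6ϑ^K` (summable; it dominates the toy's explicit relative shell weight
`2·(3∕(1−ϑ^K∕2))·(ϑ^K∕2) ≤ 6ϑ^K`) satisfies the HYPOTHESIS of `s_N21_sRec₁₃CoPH_of_dilationLevels` at EVERY Stage-13 tuple (no
admissibility or record fact used), hence `S_N21 (SRec₁₃CoPH cr₀)` by §3 — the binder is not void; whether any admissible Stage-13 tuple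
with provisos EXISTS is K0⁷ (open) and is not touched. [folklore] -/
theorem s_N21_sRec₁₃CoPH_of_dilationLevels_fires {N : ℕ} [NeZero N] (l₀ : ℝ) {ϑ : ℝ} (h0 : 0 < ϑ) (h1 : ϑ < 1) :
    S_N21 (SRec₁₃CoPH (N := N) fun _ _ _ _ _ =>
      { ι := Unit, l₀ := l₀, vol := 1, K₀ := 0, T := T, A := A, B := A, shA := sh ϑ, shB := sh ϑ, Bad := fun _ _ => ∅,
        W := fun _ => 0, Wsh := fun K => 6 * ϑ ^ K, δ := fun _ => 0 }) := by
  have hL := dilationLevels_toyLedger l₀ h0.le h1.le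
  refine s_N21_sRec₁₃CoPH_of_dilationLevels _ fun F θ hP _ g₀ os => ⟨(summable_geometric_of_lt_one h0.le h1).mul_left 6, ?_⟩
  refine ⟨Unit, Unit, S, S, piece ϑ, piece ϑ, lvl, lvl, fun _ => 1, fun _ => 0, fun j => ϑ ^ j / 2, fun _ => 1, fun _ => 0,
    fun j => ϑ ^ j / 2, 0, 1, 1, 0, 1 / 2, ϑ, 0, 0, hL, hL, liveWindow, liveWindow, h0.le, h1, fun _ => zero_le_one, ?_,
    fun _ => zero_le_one, ?_, fun _ => le_rfl, ?_, fun _ => le_rfl, ?_, ?_, ?_, ?_, ?_, ?_⟩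
  · intro j; simp
  · intro j; simp
  · intro j; simp
  · intro j; simp
  · intro j; have := pow_le_one₀ h0.le h1.le (n := j); linarith
  · intro j; linarith
  · intro j; have := pow_le_one₀ h0.le h1.le (n := j); linarith
  · intro j; linarith
  · intro K
    have hx0 : 0 ≤ ϑ ^ K := pow_nonneg h0.le K
    have hx1 : ϑ ^ K ≤ 1 := pow_le_one₀ h0.le h1.le
    have hden : 0 < 1 - ϑ ^ K / 2 := by linarith
    have hq : 3 * ((0 : ℝ) + 1) / (1 - ϑ ^ K / 2) * (ϑ ^ K / 2) ≤ 3 * ϑ ^ K := by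
      rw [div_mul_eq_mul_div, div_le_iff₀ hden]
      nlinarith
    simp only [S, lvl, sum_singleton, one_mul]
    linarith

end Sanity

end Summit.QuantumFields.YangMills.Theorems.N21DilationRoadAtRecord13CoPH
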